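import Summits.KontsevichZagierPeriods.KontsevichZagierPeriods.Theses.KinematicFormulas
import Summits.KontsevichZagierPeriods.KontsevichZagierPeriods.Theorems.InverseLandauTateLiftingPullback
import Literature.NumberTheory.Transcendental.KZProductIdeal
import Literature.NumberTheory.Transcendental.KZDilationMove
import Literature.NumberTheory.Transcendental.KZDominatedFamilyRelations

/-!
# `SchurSO3` (stmt-KontsevichZagierPeriods-5398, route KinematicFormulas) — proof

Schur orthogonality `∫_{SO(3)} R₁₁² dg = (1/3) ∫_{SO(3)} dg` INSIDE the Kontsevich–Zagier rules. In the
gnomonic Euler–Rodrigues (Cayley) chart `w ∈ ℝ³` of `SO(3)` (unit quaternion `(1, w)/√(1+|w|²)`) the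
Haar density is `ρ = (1+|w|²)⁻²` and the first row of the rotation matrix `R(w)` is
`(R₁₁, R₁₂, R₁₃) = (1 + w₀² − w₁² − w₂², 2(w₀w₁ − w₂), 2(w₀w₂ + w₁))/(1+|w|²)`. The item says
`3·[ℝ³, R₁₁² ρ] − [ℝ³, ρ] ∈ KZ.relations`. Moves: (1) integrand additivity on `ℝ³` for the pointwise
identity `ρ = R₁₁²ρ + R₁₂²ρ + R₁₃²ρ` (the row is a unit vector); (2) ONE change of variables (rule 2,
`InverseLandau.tateLifting_pullback`) along the right translation by the quarter turn about the
`w₂`-axis, which in the chart is the `ℚ`-rational bijection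
`Φ(w) = ((w₀ + w₁), (w₁ − w₀), (1 + w₂))/(1 − w₂)` of `{w₂ ≠ 1}` onto `{w₂ ≠ −1}` with
`|det Φ′| = 4/(1 − w₂)⁴` and `R₁₁ ∘ Φ = R₁₂`, `ρ(Φ w)·|det Φ′| = ρ(w)` (invariance of Haar measure), so
`[ℝ³, R₁₁²ρ] ∼ [ℝ³, R₁₂²ρ]` after discarding the two null planes `{w₂ = ±1}` (domain additivity);
(3) `[ℝ³, R₁₂²ρ] ∼ [ℝ³, R₁₃²ρ]` by swapping the coordinates `w₁ ↔ w₂` (a reindexing move) and reflecting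
`w ↦ −w` (a dilation move), since `R₁₃²(w₀, w₂, w₁) = R₁₂²(−w)`. Bookkeeping:
`3[R₁₁²ρ] − [ρ] = −([ρ] − [R₁₁²ρ] − [R₁₂²ρ] − [R₁₃²ρ]) + 2([R₁₁²ρ] − [R₁₂²ρ]) + ([R₁₂²ρ] − [R₁₃²ρ])`.

References: M. Kontsevich, D. Zagier, *Periods* (2001), §1.2 rules (1)–(2); B. Collins, P. Śniady,
*Integration with respect to the Haar measure on unitary, orthogonal and symplectic group* (2006).
-/

noncomputable section

open MeasureTheory Set
open Literature.NumberTheory.Transcendental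
open Literature.ModelTheory.ExponentialFields (IsSemialgebraic isSemialgebraic_univ)
open MvPolynomial (aeval X C)

namespace Summit.KontsevichZagierPeriods.KinematicFormulas

namespace SchurSO3

/-! ## Pointwise identities of the Cayley chart -/

/-- The first row of the Cayley rotation matrix is a unit vector:
`ρ = R₁₁²ρ + (R₁₂²ρ + R₁₃²ρ)` with `ρ = (1+|w|²)⁻²`. [folklore] -/
theorem rowSum_identity (a b c : ℝ) :
    1 / (1 + a ^ 2 + b ^ 2 + c ^ 2) ^ 2 =
      (1 + a ^ 2 - b ^ 2 - c ^ 2) ^ 2 / (1 + a ^ 2 + b ^ 2 + c ^ 2) ^ 4 +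
        (4 * (a * b - c) ^ 2 / (1 + a ^ 2 + b ^ 2 + c ^ 2) ^ 4 +
          4 * (a * c + b) ^ 2 / (1 + a ^ 2 + b ^ 2 + c ^ 2) ^ 4) := by
  have hS : (1 + a ^ 2 + b ^ 2 + c ^ 2 : ℝ) ≠ 0 := by positivity
  rw [← add_div, ← add_div, div_eq_div_iff (pow_ne_zero 2 hS) (pow_ne_zero 4 hS)]
  ring

/-- An entry of an orthogonal row is at most `1` in absolute value: if `S² = N² + 4m² + 4m'²` and
`S > 0` then `4m²/S⁴ ≤ 1/S²`. [folklore] -/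
theorem entry_le (N m m' S : ℝ) (hS : 0 < S) (key : S ^ 2 = N ^ 2 + 4 * m ^ 2 + 4 * m' ^ 2) :
    4 * m ^ 2 / S ^ 4 ≤ 1 / S ^ 2 := by
  rw [div_le_div_iff₀ (by positivity) (by positivity), one_mul]
  have h1 : 4 * m ^ 2 ≤ S ^ 2 := by rw [key]; nlinarith [sq_nonneg N, sq_nonneg m']
  calc 4 * m ^ 2 * S ^ 2 ≤ S ^ 2 * S ^ 2 := mul_le_mul_of_nonneg_right h1 (sq_nonneg S)
    _ = S ^ 4 := by ring

/-- **Transport of `R₁₁²ρ` along the quarter turn**: with `Φ(a, b, c) = ((a+b), (b−a), (1+c))/(1−c)`,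
`|det Φ′|·(R₁₁²ρ)(Φ w) = (R₁₂²ρ)(w)`, i.e. `R₁₁ ∘ Φ = R₁₂` and `ρ ∘ Φ · |det Φ′| = ρ` (invariance of the
Haar density under a right translation). [folklore] -/
theorem pull_identity (a b c : ℝ) (h : 1 - c ≠ 0) :
    4 / (1 - c) ^ 4 * ((1 + ((a + b) / (1 - c)) ^ 2 - ((b - a) / (1 - c)) ^ 2 -
        ((1 + c) / (1 - c)) ^ 2) ^ 2 / (1 + ((a + b) / (1 - c)) ^ 2 + ((b - a) / (1 - c)) ^ 2 +
        ((1 + c) / (1 - c)) ^ 2) ^ 4) = 4 * (a * b - c) ^ 2 / (1 + a ^ 2 + b ^ 2 + c ^ 2) ^ 4 := by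
  have hS : (1 + a ^ 2 + b ^ 2 + c ^ 2 : ℝ) ≠ 0 := by positivity
  have e1 : 1 + ((a + b) / (1 - c)) ^ 2 + ((b - a) / (1 - c)) ^ 2 + ((1 + c) / (1 - c)) ^ 2 =
      2 * (1 + a ^ 2 + b ^ 2 + c ^ 2) / (1 - c) ^ 2 := by
    field_simp
    ring
  have e2 : 1 + ((a + b) / (1 - c)) ^ 2 - ((b - a) / (1 - c)) ^ 2 - ((1 + c) / (1 - c)) ^ 2 =
      4 * (a * b - c) / (1 - c) ^ 2 := by
    field_simp
    ring
  rw [e1, e2]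
  field_simp
  ring

/-- Derivative of the third coordinate `t ↦ (1 + t)/(1 − t)` of the quarter turn: `2/(1 − t)²`.
[folklore] -/
theorem hasDerivAt_tanAdd {t : ℝ} (ht : 1 - t ≠ 0) :
    HasDerivAt (fun s : ℝ => (1 + s) / (1 - s)) (2 / (1 - t) ^ 2) t := by
  have h1 : HasDerivAt (fun s : ℝ => 1 + s) 1 t := (hasDerivAt_id' t).const_add 1
  have h2 : HasDerivAt (fun s : ℝ => 1 - s) (-1) t := (hasDerivAt_id' t).const_sub 1
  exact (h1.fun_div h2 ht).congr_deriv (by ring)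

/-- The Jacobian matrix of the quarter turn at `w` (with `w₂ ≠ 1`) has determinant `4/(1 − w₂)⁴`
(cofactor expansion, `Matrix.det_fin_three`). [folklore] -/
theorem det_jac {w : Fin 3 → ℝ} (hw : 1 - w 2 ≠ 0) :
    (LinearMap.toContinuousLinearMap (Matrix.toLin'
        !![1 / (1 - w 2), 1 / (1 - w 2), (w 0 + w 1) / (1 - w 2) ^ 2;
           -(1 / (1 - w 2)), 1 / (1 - w 2), (w 1 - w 0) / (1 - w 2) ^ 2;
           0, 0, 2 / (1 - w 2) ^ 2])).det = 4 / (1 - w 2) ^ 4 := by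
  rw [LinearMap.det_toContinuousLinearMap, LinearMap.det_toLin', Matrix.det_fin_three]
  simp only [Matrix.of_apply, Matrix.cons_val', Matrix.cons_val_zero, Matrix.cons_val_one,
    Matrix.cons_val_two, Matrix.cons_val_fin_one, Matrix.head_cons, Matrix.tail_cons,
    Matrix.empty_val', Matrix.head_fin_const]
  field_simp
  ring

/-- **The quarter turn in Cayley coordinates.** Right translation by the rotation through `π/2` about
the `w₂`-axis (Cayley parameter `q = (0, 0, 1)`) is, in the chart, the `ℚ`-rational map
`Φ(w) = (w + q + w × q)/(1 − ⟨w, q⟩) = ((w₀ + w₁), (w₁ − w₀), (1 + w₂))/(1 − w₂)`: a `ℚ`-semialgebraic,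
differentiable, injective map of `{w₂ ≠ 1}` onto `{w₂ ≠ −1}` (inverse the translation by `q̄`) with
`|det Φ′(w)| = 4/(1 − w₂)⁴` — exactly the data of Kontsevich–Zagier's rule (2).
[cite: KontsevichZagier2001, §1.2 rule (2)] -/
theorem exists_quarterTurn :
    ∃ (Φ : (Fin 3 → ℝ) → (Fin 3 → ℝ)) (Φ' : (Fin 3 → ℝ) → (Fin 3 → ℝ) →L[ℝ] (Fin 3 → ℝ)),
      (∀ w, Φ w 0 = (w 0 + w 1) / (1 - w 2)) ∧ (∀ w, Φ w 1 = (w 1 - w 0) / (1 - w 2)) ∧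
      (∀ w, Φ w 2 = (1 + w 2) / (1 - w 2)) ∧
      IsSemialgebraicMapOn ℚ {w : Fin 3 → ℝ | w 2 ≠ 1} Φ ∧
      (∀ w ∈ {w : Fin 3 → ℝ | w 2 ≠ 1}, HasFDerivWithinAt Φ (Φ' w) {w : Fin 3 → ℝ | w 2 ≠ 1} w) ∧
      InjOn Φ {w : Fin 3 → ℝ | w 2 ≠ 1} ∧
      Φ '' {w : Fin 3 → ℝ | w 2 ≠ 1} = {w : Fin 3 → ℝ | w 2 ≠ -1} ∧
      (∀ w ∈ {w : Fin 3 → ℝ | w 2 ≠ 1}, (4 / (1 - w 2) ^ 4 : ℝ) = |(Φ' w).det|) := by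
  set Φ : (Fin 3 → ℝ) → (Fin 3 → ℝ) := fun x =>
    ![(x 0 + x 1) / (1 - x 2), (x 1 - x 0) / (1 - x 2), (1 + x 2) / (1 - x 2)] with hΦ
  set Φ' : (Fin 3 → ℝ) → (Fin 3 → ℝ) →L[ℝ] (Fin 3 → ℝ) := fun w =>
    LinearMap.toContinuousLinearMap (Matrix.toLin'
      !![1 / (1 - w 2), 1 / (1 - w 2), (w 0 + w 1) / (1 - w 2) ^ 2;
         -(1 / (1 - w 2)), 1 / (1 - w 2), (w 1 - w 0) / (1 - w 2) ^ 2;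
         0, 0, 2 / (1 - w 2) ^ 2]) with hΦ'
  have hΦ0 : ∀ w, Φ w 0 = (w 0 + w 1) / (1 - w 2) := fun w => rfl
  have hΦ1 : ∀ w, Φ w 1 = (w 1 - w 0) / (1 - w 2) := fun w => rfl
  have hΦ2 : ∀ w, Φ w 2 = (1 + w 2) / (1 - w 2) := fun w => rfl
  have hne : ∀ w ∈ {w : Fin 3 → ℝ | w 2 ≠ 1}, (1 : ℝ) - w 2 ≠ 0 :=
    fun w hw => sub_ne_zero.2 (Ne.symm hw)
  have hD : IsSemialgebraic ℚ {w : Fin 3 → ℝ | w 2 ≠ 1} := by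
    convert Literature.ModelTheory.ExponentialFields.isSemialgebraic_setOf_eval_ne_zero (k := ℚ)
      (R := ℝ) (X 2 - 1 : MvPolynomial (Fin 3) ℚ) using 1
    ext w
    simp [sub_ne_zero]
  refine ⟨Φ, Φ', hΦ0, hΦ1, hΦ2, ?_, fun w hw => ?_, ?_, ?_, fun w hw => ?_⟩
  · -- a `ℚ`-rational map is `ℚ`-semialgebraic
    have hq : ∀ x ∈ {w : Fin 3 → ℝ | w 2 ≠ 1}, aeval x (1 - X 2 : MvPolynomial (Fin 3) ℚ) ≠ 0 := by
      intro x hx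
      rw [map_sub, map_one, MvPolynomial.aeval_X]
      exact hne x hx
    refine IsSemialgebraicMapOn.of_forall hD fun j => ?_
    fin_cases j
    · exact (isSemialgebraicFunOn_aeval_div_aeval hD (X 0 + X 1) _ hq).congr fun x _ => by simp [hΦ0]
    · exact (isSemialgebraicFunOn_aeval_div_aeval hD (X 1 - X 0) _ hq).congr fun x _ => by simp [hΦ1]
    · exact (isSemialgebraicFunOn_aeval_div_aeval hD (1 + X 2) _ hq).congr fun x _ => by simp [hΦ2]
  · -- differentiable, with derivative the Jacobian matrix (coordinatewise)
    have hw' := hne w hw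
    have hp : ∀ j : Fin 3, HasFDerivAt (fun x : Fin 3 → ℝ => x j)
        (ContinuousLinearMap.proj (R := ℝ) (φ := fun _ : Fin 3 => ℝ) j) w :=
      fun j => hasFDerivAt_apply j w
    have hinv : HasFDerivAt (fun x : Fin 3 → ℝ => (1 - x 2)⁻¹)
        ((-((1 - w 2) ^ 2)⁻¹) • -(ContinuousLinearMap.proj (R := ℝ) (φ := fun _ : Fin 3 => ℝ) 2)) w :=
      (hasDerivAt_inv hw').comp_hasFDerivAt w ((hp 2).const_sub 1)
    have h3 := (hasDerivAt_tanAdd hw').comp_hasFDerivAt w (hp 2)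
    refine HasFDerivAt.hasFDerivWithinAt ?_
    rw [hasFDerivAt_pi']
    intro i
    fin_cases i
    · refine ((((hp 0).add (hp 1)).fun_mul hinv).congr_fderiv
        (ContinuousLinearMap.ext fun v => ?_)).congr_of_eventuallyEq
        (Filter.Eventually.of_forall fun x => ?_)
      · simp [hΦ', Matrix.toLin'_apply, dotProduct, Fin.sum_univ_three]
        ring
      · simp [hΦ0, div_eq_mul_inv]
    · refine ((((hp 1).sub (hp 0)).fun_mul hinv).congr_fderiv
        (ContinuousLinearMap.ext fun v => ?_)).congr_of_eventuallyEq
        (Filter.Eventually.of_forall fun x => ?_)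
      · simp [hΦ', Matrix.toLin'_apply, dotProduct, Fin.sum_univ_three]
        ring
      · simp [hΦ1, div_eq_mul_inv]
    · refine (h3.congr_fderiv (ContinuousLinearMap.ext fun v => ?_)).congr_of_eventuallyEq
        (Filter.Eventually.of_forall fun x => ?_)
      · simp [hΦ', Matrix.toLin'_apply, dotProduct, Fin.sum_univ_three]
      · simp [hΦ2]
  · -- injective: the third coordinate determines `w₂`, then the first two determine `w₀, w₁`
    intro x hx y hy hxy
    have hx' := hne x hx
    have hy' := hne y hy
    have h2 : (1 + x 2) / (1 - x 2) = (1 + y 2) / (1 - y 2) := by rw [← hΦ2, ← hΦ2, hxy]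
    rw [div_eq_div_iff hx' hy'] at h2
    have e2 : x 2 = y 2 := by linear_combination h2 / 2
    have h0 : (x 0 + x 1) / (1 - x 2) = (y 0 + y 1) / (1 - y 2) := by rw [← hΦ0, ← hΦ0, hxy]
    have h1 : (x 1 - x 0) / (1 - x 2) = (y 1 - y 0) / (1 - y 2) := by rw [← hΦ1, ← hΦ1, hxy]
    rw [e2, div_left_inj' hy'] at h0 h1
    funext i
    fin_cases i
    · show x 0 = y 0
      linarith
    · show x 1 = y 1
      linarith
    · exact e2
  · -- onto `{w₂ ≠ -1}`: the inverse is the translation by the conjugate quarter turn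
    ext v
    constructor
    · rintro ⟨x, hx, rfl⟩
      show Φ x 2 ≠ -1
      rw [hΦ2, Ne, div_eq_iff (hne x hx)]
      intro h
      linarith
    · intro hv
      have hv' : (1 : ℝ) + v 2 ≠ 0 := fun h => hv (by show v 2 = -1; linarith)
      have e1 : (1 : ℝ) - (v 2 - 1) / (1 + v 2) = 2 * 1 / (1 + v 2) := by field_simp; ring
      have e2 : (v 0 - v 1) / (1 + v 2) + (v 0 + v 1) / (1 + v 2) = 2 * v 0 / (1 + v 2) := by ring
      have e3 : (v 0 + v 1) / (1 + v 2) - (v 0 - v 1) / (1 + v 2) = 2 * v 1 / (1 + v 2) := by ring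
      have e4 : (1 : ℝ) + (v 2 - 1) / (1 + v 2) = 2 * v 2 / (1 + v 2) := by field_simp; ring
      have cancel : ∀ a : ℝ, 2 * a / (1 + v 2) / (2 * 1 / (1 + v 2)) = a := fun a => by field_simp
      refine ⟨![(v 0 - v 1) / (1 + v 2), (v 0 + v 1) / (1 + v 2), (v 2 - 1) / (1 + v 2)], ?_, ?_⟩
      · show (v 2 - 1) / (1 + v 2) ≠ 1
        rw [Ne, div_eq_iff hv']
        intro h
        linarith
      · funext i
        fin_cases i
        · show ((v 0 - v 1) / (1 + v 2) + (v 0 + v 1) / (1 + v 2)) / (1 - (v 2 - 1) / (1 + v 2)) = v 0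
          rw [e1, e2, cancel]
        · show ((v 0 + v 1) / (1 + v 2) - (v 0 - v 1) / (1 + v 2)) / (1 - (v 2 - 1) / (1 + v 2)) = v 1
          rw [e1, e3, cancel]
        · show (1 + (v 2 - 1) / (1 + v 2)) / (1 - (v 2 - 1) / (1 + v 2)) = v 2
          rw [e1, e4, cancel]
  · -- the Jacobian determinant
    rw [hΦ', det_jac (hne w hw), abs_of_nonneg (by positivity)]

/-- An honest representation `[ℝ³, g]` for a `ℚ`-semialgebraic `g` with `0 ≤ g ≤ ρ = (1+|w|²)⁻²`, given
ANY honest representation `r'` of `ρ` over `ℝ³` (absolute integrability by domination). [folklore] -/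
theorem exists_rep_of_le (r' : KZ.IntegralRep 3) (hd : r'.domain = Set.univ)
    (hi : EqOn r'.integrand (fun w => 1 / (1 + w 0 ^ 2 + w 1 ^ 2 + w 2 ^ 2) ^ 2) r'.domain)
    {g : (Fin 3 → ℝ) → ℝ} (hg : IsSemialgebraicFunOn ℚ (Set.univ : Set (Fin 3 → ℝ)) g)
    (h0 : ∀ w, 0 ≤ g w) (hle : ∀ w, g w ≤ 1 / (1 + w 0 ^ 2 + w 1 ^ 2 + w 2 ^ 2) ^ 2) :
    ∃ F : KZ.IntegralRep 3, F.domain = Set.univ ∧ F.integrand = g := by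
  have h1 : IntegrableOn r'.integrand univ := hd ▸ r'.integrableOn
  have hint : IntegrableOn g univ := by
    refine Integrable.mono' h1
      (KZ.aestronglyMeasurable_of_isSemialgebraicFunOn hg MeasurableSet.univ)
      (Filter.Eventually.of_forall fun w => ?_)
    rw [Real.norm_eq_abs, abs_of_nonneg (h0 w), hi (by rw [hd]; exact mem_univ w)]
    exact hle w
  exact ⟨⟨univ, g, isSemialgebraic_univ, hg, hint⟩, rfl, rfl⟩

/-- The complement `{w₂ ≠ c}` of a coordinate plane with rational `c` is `ℚ`-semialgebraic.
[cite: BCR1998, §2.1] -/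
theorem isSemialgebraic_ne (c : ℚ) : IsSemialgebraic ℚ {w : Fin 3 → ℝ | w 2 ≠ (c : ℝ)} := by
  convert Literature.ModelTheory.ExponentialFields.isSemialgebraic_setOf_eval_ne_zero (k := ℚ)
    (R := ℝ) (X 2 - C c : MvPolynomial (Fin 3) ℚ) using 1
  ext w
  simp [sub_ne_zero]

/-- The honest representations `[ℝ³, 4m²/(1+|w|²)⁴]` of the squared off-diagonal row entries
`R₁₂²ρ` (`m = w₀w₁ − w₂`) and `R₁₃²ρ` (`m = w₀w₂ + w₁`) exist, given any honest representation of
`ρ` over `ℝ³`. [folklore] -/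
theorem exists_rowReps (r' : KZ.IntegralRep 3) (hd : r'.domain = Set.univ)
    (hi : EqOn r'.integrand (fun w => 1 / (1 + w 0 ^ 2 + w 1 ^ 2 + w 2 ^ 2) ^ 2) r'.domain) :
    ∃ F₂ F₃ : KZ.IntegralRep 3, F₂.domain = Set.univ ∧
      (F₂.integrand = fun w => 4 * (w 0 * w 1 - w 2) ^ 2 / (1 + w 0 ^ 2 + w 1 ^ 2 + w 2 ^ 2) ^ 4) ∧
      F₃.domain = Set.univ ∧
      (F₃.integrand = fun w => 4 * (w 0 * w 2 + w 1) ^ 2 / (1 + w 0 ^ 2 + w 1 ^ 2 + w 2 ^ 2) ^ 4) := by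
  have hq : ∀ x ∈ (Set.univ : Set (Fin 3 → ℝ)),
      aeval x ((1 + X 0 ^ 2 + X 1 ^ 2 + X 2 ^ 2) ^ 4 : MvPolynomial (Fin 3) ℚ) ≠ 0 := by
    intro x _
    simp only [map_pow, map_add, map_one, MvPolynomial.aeval_X]
    positivity
  obtain ⟨F₂, hF₂d, hF₂i⟩ := exists_rep_of_le r' hd hi
    (g := fun w => 4 * (w 0 * w 1 - w 2) ^ 2 / (1 + w 0 ^ 2 + w 1 ^ 2 + w 2 ^ 2) ^ 4)
    ((isSemialgebraicFunOn_aeval_div_aeval isSemialgebraic_univ (4 * (X 0 * X 1 - X 2) ^ 2) _ hq).congr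
      fun x _ => by simp)
    (fun w => by positivity)
    (fun w => entry_le (1 + w 0 ^ 2 - w 1 ^ 2 - w 2 ^ 2) _ (w 0 * w 2 + w 1) _ (by positivity) (by ring))
  obtain ⟨F₃, hF₃d, hF₃i⟩ := exists_rep_of_le r' hd hi
    (g := fun w => 4 * (w 0 * w 2 + w 1) ^ 2 / (1 + w 0 ^ 2 + w 1 ^ 2 + w 2 ^ 2) ^ 4)
    ((isSemialgebraicFunOn_aeval_div_aeval isSemialgebraic_univ (4 * (X 0 * X 2 + X 1) ^ 2) _ hq).congr
      fun x _ => by simp)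
    (fun w => by positivity)
    (fun w => entry_le (1 + w 0 ^ 2 - w 1 ^ 2 - w 2 ^ 2) _ (w 0 * w 1 - w 2) _ (by positivity) (by ring))
  exact ⟨F₂, F₃, hF₂d, hF₂i, hF₃d, hF₃i⟩

end SchurSO3

open SchurSO3

/-- **`SchurSO3`** (route KinematicFormulas, stmt-KontsevichZagierPeriods-5398): for every
`r = [ℝ³, R₁₁²ρ]`, `R₁₁²ρ = (1 + w₀² − w₁² − w₂²)²/(1+|w|²)⁴`, and every `r' = [ℝ³, ρ]`, `ρ = (1+|w|²)⁻²`
(Haar measure of `SO(3)` in the Cayley chart), `3·[r] − [r'] ∈ KZ.relations` — Schur orthogonality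
`∫ R₁₁² dHaar = 1/3` inside the rules: integrand additivity for `ρ = (R₁₁² + R₁₂² + R₁₃²)ρ`, one change
of variables along the rational quarter turn `Φ` (`R₁₁ ∘ Φ = R₁₂`, Haar-invariant) off two null planes,
and a coordinate swap plus the reflection `w ↦ −w` carrying `R₁₂²ρ` to `R₁₃²ρ`.
[cite: KontsevichZagier2001, §1.2] -/
theorem schurSO3_proof :
    Summit.KontsevichZagierPeriods.KontsevichZagierPeriods.Theses.KinematicFormulas.SchurSO3 := by
  intro r r' hrd hri hr'd hr'i
  obtain ⟨F₂, F₃, hF₂d, hF₂i, hF₃d, hF₃i⟩ := exists_rowReps r' hr'd hr'i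
  have hxr : ∀ x : Fin 3 → ℝ, x ∈ r.domain := fun x => by rw [hrd]; exact mem_univ x
  -- Step 1: integrand additivity `ρ = R₁₁²ρ + R₁₂²ρ + R₁₃²ρ` on `ℝ³`
  have hsum : KZ.of r' - KZ.of r - (KZ.of F₂ + KZ.of F₃) ∈ KZ.relations := by
    have h := KZ.of_sub_of_sub_sum_mem_relations 2 r' r ![F₂, F₃] (by rw [hrd, hr'd])
      (Fin.forall_fin_two.2 ⟨by simp [hF₂d, hr'd], by simp [hF₃d, hr'd]⟩) fun x hx => ?_
    · simpa [Fin.sum_univ_two] using h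
    · simp only [Fin.sum_univ_two, Matrix.cons_val_zero, Matrix.cons_val_one, Matrix.cons_val_fin_one]
      rw [hr'i hx, hri (hxr x), hF₂i, hF₃i]
      exact rowSum_identity (x 0) (x 1) (x 2)
  -- Step 2: `[ℝ³, R₁₁²ρ] ∼ [ℝ³, R₁₂²ρ]`: ONE change of variables along the quarter turn
  have h12 : KZ.of r - KZ.of F₂ ∈ KZ.relations := by
    obtain ⟨Φ, Φ', hΦ0, hΦ1, hΦ2, hsa, hderiv, hinj, himage, hdet⟩ := exists_quarterTurn
    have hD : IsSemialgebraic ℚ {w : Fin 3 → ℝ | w 2 ≠ 1} := by simpa using isSemialgebraic_ne 1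
    have hD' : IsSemialgebraic ℚ {w : Fin 3 → ℝ | w 2 ≠ -1} := by simpa using isSemialgebraic_ne (-1)
    have hD'r : {w : Fin 3 → ℝ | w 2 ≠ -1} ⊆ r.domain := fun x _ => hxr x
    have hDF : {w : Fin 3 → ℝ | w 2 ≠ 1} ⊆ F₂.domain := by rw [hF₂d]; exact subset_univ _
    -- (a) discard the null plane `{w₂ = -1}` from `r`
    have ha : KZ.of r - KZ.of (r.restrict _ hD' hD'r) ∈ KZ.relations := by
      refine r.of_sub_of_restrict_mem_relations hD' hD'r ?_
      rw [hrd, show (univ : Set (Fin 3 → ℝ)) \ {w | w 2 ≠ -1} = {w | w 2 = -1} from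
        Set.ext fun w => by simp, MeasureTheory.volume_pi]
      exact Measure.pi_hyperplane (fun _ : Fin 3 => (volume : Measure ℝ)) (2 : Fin 3) (-1)
    -- (b) pull `[{w₂ ≠ -1}, R₁₁²ρ]` back along `Φ` (rule 2)
    have hJ : IsSemialgebraicFunOn ℚ {w : Fin 3 → ℝ | w 2 ≠ 1} (fun w => 4 / (1 - w 2) ^ 4) := by
      refine (isSemialgebraicFunOn_aeval_div_aeval hD (4 : MvPolynomial (Fin 3) ℚ) ((1 - X 2) ^ 4)
        fun x hx => ?_).congr fun x _ => by simp
      simp only [map_pow, map_sub, map_one, MvPolynomial.aeval_X]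
      exact pow_ne_zero 4 (sub_ne_zero.2 (Ne.symm hx))
    obtain ⟨r₂, hr₂d, hr₂i, hb⟩ := InverseLandau.tateLifting_pullback 3 (r.restrict _ hD' hD'r)
      {w : Fin 3 → ℝ | w 2 ≠ 1} Φ Φ' (fun w => 4 / (1 - w 2) ^ 4) hD hsa hderiv hinj himage hJ hdet
    -- (c) the pulled-back integrand is `R₁₂²ρ` on `{w₂ ≠ 1}`
    have hc : KZ.of r₂ - KZ.of (F₂.restrict _ hD hDF) ∈ KZ.relations := by
      refine KZ.of_sub_of_mem_relations_of_eqOn (by rw [KZ.IntegralRep.domain_restrict, hr₂d])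
        fun x hx => ?_
      rw [hr₂d] at hx
      rw [hr₂i, KZ.IntegralRep.integrand_restrict, KZ.IntegralRep.integrand_restrict, hF₂i]
      dsimp only
      rw [hri (hxr _)]
      simp only [hΦ0, hΦ1, hΦ2]
      exact pull_identity (x 0) (x 1) (x 2) (sub_ne_zero.2 (Ne.symm hx))
    -- (d) discard the null plane `{w₂ = 1}` from `[ℝ³, R₁₂²ρ]`
    have hd : KZ.of F₂ - KZ.of (F₂.restrict _ hD hDF) ∈ KZ.relations := by
      refine F₂.of_sub_of_restrict_mem_relations hD hDF ?_
      rw [hF₂d, show (univ : Set (Fin 3 → ℝ)) \ {w | w 2 ≠ 1} = {w | w 2 = 1} from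
        Set.ext fun w => by simp, MeasureTheory.volume_pi]
      exact Measure.pi_hyperplane (fun _ : Fin 3 => (volume : Measure ℝ)) (2 : Fin 3) 1
    have key : KZ.of r - KZ.of F₂ = (KZ.of r - KZ.of (r.restrict _ hD' hD'r)) +
        (KZ.of (r.restrict _ hD' hD'r) - KZ.of r₂) + (KZ.of r₂ - KZ.of (F₂.restrict _ hD hDF)) -
        (KZ.of F₂ - KZ.of (F₂.restrict _ hD hDF)) := by abel
    rw [key]
    exact sub_mem (add_mem (add_mem ha hb) hc) hd
  -- Step 3: `[ℝ³, R₁₂²ρ] ∼ [ℝ³, R₁₃²ρ]`: swap `w₁ ↔ w₂`, then reflect `w ↦ -w`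
  have h23 : KZ.of F₂ - KZ.of F₃ ∈ KZ.relations := by
    have he : KZ.of F₃ - KZ.of (F₃.reindex (Equiv.swap 1 2)) ∈ KZ.relations :=
      KZ.of_sub_of_reindex_mem_relations F₃ (Equiv.swap 1 2)
    have hf : KZ.of (F₃.reindex (Equiv.swap 1 2)) - KZ.of F₂ ∈ KZ.relations := by
      refine KZ.smul_sub_mem_relations (s := (-1 : ℝ)) isAlgebraic_one.neg (by norm_num) _ _ ?_ ?_
      · rw [hF₂d, eq_comm, Set.eq_univ_iff_forall]
        intro v
        exact ⟨(-1 : ℝ) • v, by simp [hF₃d], by simp⟩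
      · intro x _
        have e0 : Equiv.swap (1 : Fin 3) 2 0 = 0 := by decide
        have e1 : Equiv.swap (1 : Fin 3) 2 1 = 2 := by decide
        have e2 : Equiv.swap (1 : Fin 3) 2 2 = 1 := by decide
        simp only [KZ.IntegralRep.reindex_integrand, hF₃i, hF₂i, e0, e1, e2, Pi.smul_apply,
          smul_eq_mul, abs_neg, abs_one, one_pow, mul_one]
        ring
    have key : KZ.of F₂ - KZ.of F₃ = -((KZ.of F₃ - KZ.of (F₃.reindex (Equiv.swap 1 2))) +
        (KZ.of (F₃.reindex (Equiv.swap 1 2)) - KZ.of F₂)) := by abel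
    rw [key]
    exact neg_mem (add_mem he hf)
  -- Step 4: bookkeeping in the free abelian group
  have key : 3 • KZ.of r - KZ.of r' = -(KZ.of r' - KZ.of r - (KZ.of F₂ + KZ.of F₃)) +
      2 • (KZ.of r - KZ.of F₂) + (KZ.of F₂ - KZ.of F₃) := by abel
  rw [key]
  exact add_mem (add_mem (neg_mem hsum) (nsmul_mem h12 2)) h23

end Summit.KontsevichZagierPeriods.KinematicFormulas

end
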